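import Mathlib
import Literature.Computability.AlgebraicComplexity.PrattTrapezoidVal
import Summits.MatrixMultiplication.MatrixMultiplication.Theorems.AutomaticSTPPDesignsAutomaticPackingThesisPrattValGadgetPowering

/-!
# The growth exponent certified by an arbitrary trapezoid-free integer gadget

K. Pratt, arXiv:2309.03878, Def. 3.2 / 4.2; tree `prattVal`.  Companion of
`…PrattValGadgetPowering` (carry-free digit-box powering of a gadget: `A, B, C ⊆ [0, n] ⊂ ℤ`,
`(A, B, C − n)` equilateral trapezoid-free, base `β > n` with `n + β ∉ A + B + C`, `T` solutions of
`a + b + c = n`; `PrattValGadget.pow_le_prattVal : T^k ≤ Val(ℤ/Mℤ)` for `M ≥ 2β^k`).  Here the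
real-analysis read-out:

* `prattVal_ge_rpow` — `∃ K > 0, ∀ M ≥ 1, K · M^{log T / log β} ≤ Val(ℤ/Mℤ)`; so a gadget with
  `T > β` certifies a growth exponent `θ = limsup log Val(ℤ_n)/log n ≥ log T/log β > 1`;
* `prattVal_ge_rpow_base_two_mul_add_one` — base `β = 2n + 1` is always admissible (Pratt's
  embedding of Prop. 4.3, powered): exponent `log T/log(2n+1)`;
* `prattVal_ge_rpow_base_add_one` — base `β = n + 1` for CARRY-FREE configurations
  (`2n + 1 ∉ A + B + C`): exponent `log T/log(n+1)`; a carry-free configuration with `T > n + 1`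
  would certify `θ > 1`, one with `T ≥ (n+1)^{4/3}` would certify `θ ≥ 4/3` (gate `gate-prattval`,
  RESULTS §F1: none exists for `n ≤ 16`, where `Val(n) = n + 1`).

No bearing on `ω`: statements about Pratt's functional `Val` only.
-/

set_option linter.dupNamespace false

namespace Summit.MatrixMultiplication.MatrixMultiplication.Theorems

open Finset Literature.Computability.AlgebraicComplexity

namespace PrattValGadget

/-- **Certified growth exponent from an arbitrary trapezoid-free integer gadget.**  A gadget in
`[0, n]` with base `β`, `n < β`, `2 ≤ β` (`(A, B, C − n)` equilateral trapezoid-free,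
`n + β ∉ A + B + C`) with at least `T ≥ 1` solutions of `a + b + c = n` certifies
`∃ K > 0, ∀ M ≥ 1, K · M^{log T/log β} ≤ Val(ℤ/Mℤ)`; i.e. the growth exponent of Pratt's
`Val(ℤ_n)` is at least `log T / log β` (which exceeds `1` iff `T > β`). -/
theorem prattVal_ge_rpow {n β : ℕ} (hβ : n < β) (h2 : 2 ≤ β) {A B C : Finset ℤ}
    (hA : ∀ a ∈ A, 0 ≤ a ∧ a ≤ (n : ℤ)) (hB : ∀ b ∈ B, 0 ≤ b ∧ b ≤ (n : ℤ))
    (hC : ∀ c ∈ C, 0 ≤ c ∧ c ≤ (n : ℤ))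
    (hE : IsEquilateralTrapezoidFree A B (C.image fun c => c - (n : ℤ)))
    (hm : ∀ a ∈ A, ∀ b ∈ B, ∀ c ∈ C, a + b + c ≠ (n : ℤ) + β)
    {T : ℕ} (hT1 : 1 ≤ T)
    (hT : T ≤ #((A ×ˢ B ×ˢ C).filter fun t => t.1 + t.2.1 + t.2.2 = (n : ℤ))) :
    ∃ K : ℝ, 0 < K ∧ ∀ (M : ℕ) (_ : NeZero M),
      K * (M : ℝ) ^ (Real.log T / Real.log β) ≤ (prattVal (ZMod M) : ℝ) := by
  have hβR : (1 : ℝ) < β := by exact_mod_cast (by omega : 1 < β)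
  have hβpos : (0 : ℝ) < β := by linarith
  have hTpos : (0 : ℝ) < T := by exact_mod_cast hT1
  have hlogb : 0 < Real.log β := Real.log_pos hβR
  have hlogT : 0 ≤ Real.log T := Real.log_nonneg (by exact_mod_cast hT1)
  set σ : ℝ := Real.log T / Real.log β with hσ
  have hσ0 : 0 ≤ σ := div_nonneg hlogT hlogb.le
  -- `β^σ = T`, hence `(β^k)^σ = T^k`
  have hpow : ∀ k : ℕ, (((β ^ k : ℕ) : ℕ) : ℝ) ^ σ = ((T ^ k : ℕ) : ℝ) := by
    intro k
    have hbm : (β : ℝ) ^ σ = T := by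
      rw [Real.rpow_def_of_pos hβpos]
      have : Real.log β * σ = Real.log T := by
        rw [hσ]; field_simp
      rw [this, Real.exp_log hTpos]
    push_cast
    rw [← Real.rpow_natCast, ← Real.rpow_mul hβpos.le, mul_comm, Real.rpow_mul hβpos.le, hbm,
      Real.rpow_natCast]
  have h4β : (0 : ℝ) < 4 * β := by positivity
  refine ⟨(1 / (4 * β) : ℝ) ^ σ, Real.rpow_pos_of_pos (by positivity) _, ?_⟩
  intro M hMne
  have hM1 : 1 ≤ M := Nat.one_le_iff_ne_zero.2 (NeZero.ne M)
  have hK : (1 / (4 * β) : ℝ) ^ σ * (M : ℝ) ^ σ = ((M : ℝ) / (4 * β)) ^ σ := by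
    rw [← Real.mul_rpow (by positivity) (by positivity)]
    congr 1
    ring
  rw [hK]
  by_cases hsmall : M < 2 * β
  · -- small moduli: `(M/(4β))^σ ≤ 1 ≤ M ≤ Val`
    have hle1 : (M : ℝ) / (4 * β) ≤ 1 := by
      rw [div_le_one h4β]
      exact_mod_cast (by omega : M ≤ 4 * β)
    calc ((M : ℝ) / (4 * β)) ^ σ ≤ 1 := Real.rpow_le_one (by positivity) hle1 hσ0
      _ ≤ (M : ℝ) := by exact_mod_cast hM1
      _ = (Fintype.card (ZMod M) : ℝ) := by rw [ZMod.card]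
      _ ≤ (prattVal (ZMod M) : ℝ) := by exact_mod_cast card_le_prattVal
  · -- large moduli: `β^k ≤ M/2 < β^(k+1)`
    push Not at hsmall
    set k : ℕ := Nat.log β (M / 2) with hk
    have hM2 : M / 2 ≠ 0 := by omega
    have hlow : β ^ k ≤ M / 2 := Nat.pow_log_le_self β hM2
    have hup : M / 2 < β ^ (k + 1) := Nat.lt_pow_succ_log_self (by omega) _
    have h2k : 2 * β ^ k ≤ M := by omega
    have hval := pow_le_prattVal hβ hA hB hC hE hm hT k M h2k
    have hMb : (M : ℝ) / (4 * β) ≤ (((β ^ k : ℕ) : ℕ) : ℝ) := by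
      rw [div_le_iff₀ h4β]
      have : M ≤ β ^ k * (4 * β) := by
        have h' : M < 2 * β ^ (k + 1) + 2 := by omega
        rw [pow_succ] at h'
        have hβk : 1 ≤ β ^ k * β := Nat.one_le_iff_ne_zero.2 (by positivity)
        nlinarith
      exact_mod_cast this
    calc ((M : ℝ) / (4 * β)) ^ σ ≤ (((β ^ k : ℕ) : ℕ) : ℝ) ^ σ :=
          Real.rpow_le_rpow (by positivity) hMb hσ0
      _ = ((T ^ k : ℕ) : ℝ) := hpow k
      _ ≤ (prattVal (ZMod M) : ℝ) := by exact_mod_cast hval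

/-! ### The two standard bases -/

/-- **Base `2n + 1` is always admissible** (Pratt's own embedding, Prop. 4.3, powered): every
configuration `(A, B, C)` in `[0, n]`, `n ≥ 1`, with `(A, B, C − n)` equilateral trapezoid-free
and `T ≥ 1` solutions of `a + b + c = n` certifies the growth exponent `log T / log (2n+1)` for
`Val(ℤ_M)` (the excluded sum `n + β = 3n + 1` exceeds every `a + b + c ≤ 3n`). -/
theorem prattVal_ge_rpow_base_two_mul_add_one {n : ℕ} (hn : 1 ≤ n) {A B C : Finset ℤ}
    (hA : ∀ a ∈ A, 0 ≤ a ∧ a ≤ (n : ℤ)) (hB : ∀ b ∈ B, 0 ≤ b ∧ b ≤ (n : ℤ))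
    (hC : ∀ c ∈ C, 0 ≤ c ∧ c ≤ (n : ℤ))
    (hE : IsEquilateralTrapezoidFree A B (C.image fun c => c - (n : ℤ)))
    {T : ℕ} (hT1 : 1 ≤ T)
    (hT : T ≤ #((A ×ˢ B ×ˢ C).filter fun t => t.1 + t.2.1 + t.2.2 = (n : ℤ))) :
    ∃ K : ℝ, 0 < K ∧ ∀ (M : ℕ) (_ : NeZero M),
      K * (M : ℝ) ^ (Real.log T / Real.log ((2 * n + 1 : ℕ) : ℝ)) ≤ (prattVal (ZMod M) : ℝ) := by
  refine prattVal_ge_rpow (β := 2 * n + 1) (by omega) (by omega) hA hB hC hE ?_ hT1 hT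
  intro a ha b hb c hc h
  obtain ⟨-, ha2⟩ := hA _ ha
  obtain ⟨-, hb2⟩ := hB _ hb
  obtain ⟨-, hc2⟩ := hC _ hc
  push_cast at h
  linarith

/-- **Base `n + 1` (carry-free configurations).**  If moreover `2n + 1 ∉ A + B + C`, the base
`β = n + 1` is admissible and the certified exponent improves to `log T / log (n+1)` — so a single
carry-free configuration beating the full line (`T > n + 1`) would certify `θ > 1`, and one with
`T ≥ (n+1)^{4/3}` would certify `θ ≥ 4/3` (gate `gate-prattval`, RESULTS §F1; none exists for
`n ≤ 16`, where `Val(n) = n + 1`). -/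
theorem prattVal_ge_rpow_base_add_one {n : ℕ} (hn : 1 ≤ n) {A B C : Finset ℤ}
    (hA : ∀ a ∈ A, 0 ≤ a ∧ a ≤ (n : ℤ)) (hB : ∀ b ∈ B, 0 ≤ b ∧ b ≤ (n : ℤ))
    (hC : ∀ c ∈ C, 0 ≤ c ∧ c ≤ (n : ℤ))
    (hE : IsEquilateralTrapezoidFree A B (C.image fun c => c - (n : ℤ)))
    (hcf : ∀ a ∈ A, ∀ b ∈ B, ∀ c ∈ C, a + b + c ≠ 2 * (n : ℤ) + 1)
    {T : ℕ} (hT1 : 1 ≤ T)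
    (hT : T ≤ #((A ×ˢ B ×ˢ C).filter fun t => t.1 + t.2.1 + t.2.2 = (n : ℤ))) :
    ∃ K : ℝ, 0 < K ∧ ∀ (M : ℕ) (_ : NeZero M),
      K * (M : ℝ) ^ (Real.log T / Real.log ((n + 1 : ℕ) : ℝ)) ≤ (prattVal (ZMod M) : ℝ) := by
  refine prattVal_ge_rpow (β := n + 1) (by omega) (by omega) hA hB hC hE ?_ hT1 hT
  intro a ha b hb c hc h
  apply hcf _ ha _ hb _ hc
  push_cast at h
  linarith

end PrattValGadget

end Summit.MatrixMultiplication.MatrixMultiplication.Theorems
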